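import Literature.NumberTheory.Automorphic.RamifiedPlaceEisensteinBasis   -- ★ p844116 B-p17 (g25) (W′1-CM0): `exists_eisenstein_coeffs_of_ramified`, `quadNormForm_integral_of_ramified`, `valued_toPlace_eq_sq_of_ramified`, the basis clauses
import Literature.NumberTheory.LocalFields.QuadraticOrderRegularRepShells   -- ★ F0P3a-p08 (g15): `QuadraticRegularRep.diagonal_inv_mul_regRep_mul_diagonal'` (LL (2.1) at `diag(1,c)`), `diagonal_inv_mul_diagonal`
import HarnessLib

/-!
# Rescaling the Eisenstein datum at a ramified CM place by a unit: `(τ; u, v) ↦ (ι(c)·τ; c·u, c²·v)`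
# (Serre, *Local Fields* I §6 Prop. 18; Labesse–Langlands 1979 §2 p. 7)

Topic `NumberTheory/Automorphic`; namespace `Literature.NumberTheory.Automorphic.UnitaryGroup`.  THEOREMS ONLY (no definition, no instance, no notation, no named fact,
no `sorry`; axioms ⊆ {propext, Classical.choice, Quot.sound}).  Cell `pub/hodgecm-mathlib` (D-0151), crux H413 = `stmt-HodgeConjecture-24833`, line «N6nsGerm», ROAD «W′»
= «R1LL-WILD» (architect A-p16 (g28) RULING A-45: (B6-P) «WLOG STANDARD POSITION», (P1) A-p12 (g20) `exists_conj_standardPosition`, (P2) B-p14 (g33) `core_of_core_conj`);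
this file is rider **(R) «EISENSTEIN RESCALE»** of (P1) (A-p12 (g20) 12:14:39Z), seat A-p01 (g22).  HONEST LABEL: HC_CM is proved only modulo the cell's 2 remaining named
inputs (hLiu418 24832, h413 24833) until rung 0 closes; this file is unconditional local algebra and pays no letter by itself.

WHY.  The standard-position conjugator of (P1) exists inside `U(Φ₂)(L_w)` only up to a determinant class in `L⁺_v^× ∕ N(L_w^×)` (order `2` at a ramified place, represented by
UNITS since `N(τ) = −v` is a uniformiser of `L⁺_v`); replacing the uniformiser `τ` of `L_w` by `ι(c)·τ` for a unit `c ∈ L⁺_v` shifts that class by `c` (the companion matrix of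
`ι(c)·τ` is `diag(1,c)⁻¹ · (c • γ_τ) · diag(1,c)` up to the scalar `c`, §3), so (P1) holds with ONE class once the Eisenstein datum is allowed to depend on `t₀`.  This file
certifies that the rescaled datum `(ι(c)·τ; c·u, c²·v)` satisfies EVERY clause the road's consumers carry for `(τ; u, v)` — so the (W′1) tree files (A-p17 (g23) I–VII, keyed on
`hu : u ∈ 𝒪`, `hu1 : |u| < 1`, `hv1 : |v| = |ϖ_F|`, `hE`), ★ CM0 and the (B6-H)∕(B6-V)∕(γ) layers apply to it VERBATIM.

SETTING.  `F := L⁺_v`, `E := L_w`, `ι := toPlace v w`, `σ := σ_w = galAdicCompletionMap c hw` at a place `w ∣ v` with `c • w = w`; `e(w|v) ≠ 1` only where a clause needs it.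
* §1 (generic `ValuativeRel` field `F`, unit `c`): `c·u ∈ 𝒪`, `|c·u| < 1`, `|c²·v| = |ϖ|` from the same for `u, v` — the (W′1) F-side hypotheses are rescaling-stable.
* §2 (the CM place): `|ι(c)·τ| = |τ|` (so `ι(c)·τ` is a uniformiser iff `τ` is), trace `ι(c)τ + σ(ι(c)τ) = ι(c·u)`, norm `ι(c)τ · σ(ι(c)τ) = −ι(c²·v)`, the Eisenstein equation
  `(ι(c)τ)² = ι(c·u)·(ι(c)τ) + ι(c²·v)`, `σ(ι(c)τ) = ι(c·u) − ι(c)τ`, the `Valued.v` clauses `|c·u| < 1`, `|c²·v| = exp(−1)`, A-p17's integral-basis binder `hE` and the two basis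
  clauses of ★ CM0 §3 at the uniformiser `ι(c)·τ`, and ONE package `eisensteinBasis_rescale` (the conjunction of ★ `exists_eisensteinBasis_of_ramified` for the rescaled datum,
  WITHOUT the existential: the datum is the given one).
* §3 (matrices over a field, `c ≠ 0`; over ★ `QuadraticRegularRep.diagonal_inv_mul_regRep_mul_diagonal'` = LL (2.1) at `diag(1,c)`): `diag(1,c⁻¹) · γ_{(u,v)} · diag(1,c) = c⁻¹ • γ_{(cu, c²v)}` for the companion matrix `γ_{(u,v)} = !![0, v; 1, u]`, the regular-representation
  form `diag(1,c⁻¹) · !![a, b v; b, a + b u] · diag(1,c) = !![a, b' (c² v); b', a + b' (c u)]` with `b' = b∕c` (so `diag(1,c⁻¹) · L⁺_v[γ_τ] · diag(1,c) = L⁺_v[γ_{cτ}]`),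
  `det (diag(1,c)) = c` and the bridge `(diag(1,c))⁻¹ = diag(1,c⁻¹)` — the three identities step (4) of (P1) consumes.

## References
* [Serre1979] J.-P. Serre, *Local Fields*, GTM 67 (1979): Ch. I §6 Prop. 18 (Eisenstein equations of uniformisers), Ch. II §1–§2.
* [LabesseLanglands1979] J.-P. Labesse, R. P. Langlands, *L-indistinguishability for SL(2)*, Canad. J. Math. 31 (1979): §2 p. 7 (the torus `a + bτ`; any uniformiser `τ`).
* [Serre1980Trees] J.-P. Serre, *Trees* (1980): Ch. II §1.3 (the action of `GL₂` modulo the centre; determinant classes).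
-/

set_option autoImplicit false

noncomputable section

open NumberField IsDedekindDomain ValuativeRel Matrix
open scoped ValuativeRel WithZero Matrix

namespace Literature.NumberTheory.Automorphic.UnitaryGroup

/-! ## §1 The F-side hypotheses `hu hu1 hv1` are stable under rescaling by a unit -/

section Generic

variable {F : Type*} [Field F] [ValuativeRel F]

/-- `|c| = 1`, `u ∈ 𝒪` ⇒ `c·u ∈ 𝒪`. [cite: Serre1979, Ch. II §1] -/
theorem mul_mem_integer_of_valuation_eq_one {c u : F} (hc : valuation F c = 1) (hu : u ∈ 𝒪[F]) : c * u ∈ 𝒪[F] := by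
  rw [Valuation.mem_integer_iff] at hu ⊢
  rw [map_mul, hc, one_mul]
  exact hu

/-- `|c| = 1`, `|u| < 1` ⇒ `|c·u| < 1`. [cite: Serre1979, Ch. II §1] -/
theorem valuation_mul_lt_one_of_valuation_eq_one {c u : F} (hc : valuation F c = 1) (hu1 : valuation F u < 1) : valuation F (c * u) < 1 := by
  rw [map_mul, hc, one_mul]
  exact hu1

/-- `|c| = 1`, `|v| = |ϖ|` ⇒ `|c²·v| = |ϖ|`. [cite: Serre1979, Ch. II §1] -/
theorem valuation_sq_mul_eq_of_valuation_eq_one {c v ϖ : F} (hc : valuation F c = 1) (hv1 : valuation F v = valuation F ϖ) :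
    valuation F (c ^ 2 * v) = valuation F ϖ := by
  rw [map_mul, map_pow, hc, one_pow, one_mul]
  exact hv1

/-- The rescaled quadratic norm form is the old one at `(p, c·q)`: `p² + p (c q') (u) − (c q')² v = p² + p q' (c u) − q'² (c² v)`. [cite: LabesseLanglands1979, §2 p. 7] -/
theorem quadNormForm_rescale {R : Type*} [CommRing R] (c u v p q : R) :
    p ^ 2 + p * q * (c * u) - q ^ 2 * (c ^ 2 * v) = p ^ 2 + p * (c * q) * u - (c * q) ^ 2 * v := by
  ring

/-- **A-p17's binder `hE` is rescaling-stable** (generic form): if `|p² + p q u − q² v| ≤ 1 ⇒ p, q ∈ 𝒪` for all `p q`, and `|c| = 1`, then the same holds for the datum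
`(c u, c² v)` (apply the hypothesis at `(p, c q)` and divide `q = c⁻¹·(c q)` by the unit). [cite: LabesseLanglands1979, §2 p. 7] -/
theorem quadNormForm_integral_rescale {c u v : F} (hc : valuation F c = 1)
    (hE : ∀ p q : F, valuation F (p ^ 2 + p * q * u - q ^ 2 * v) ≤ 1 → p ∈ 𝒪[F] ∧ q ∈ 𝒪[F]) :
    ∀ p q : F, valuation F (p ^ 2 + p * q * (c * u) - q ^ 2 * (c ^ 2 * v)) ≤ 1 → p ∈ 𝒪[F] ∧ q ∈ 𝒪[F] := by
  intro p q h
  rw [quadNormForm_rescale] at h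
  obtain ⟨hp, hcq⟩ := hE p (c * q) h
  refine ⟨hp, ?_⟩
  have hc0 : c ≠ 0 := by
    intro h0; rw [h0, map_zero] at hc; exact zero_ne_one hc
  have hcinv : valuation F c⁻¹ = 1 := by rw [map_inv₀, hc, inv_one]
  have : q = c⁻¹ * (c * q) := by rw [← mul_assoc, inv_mul_cancel₀ hc0, one_mul]
  rw [this]
  exact mul_mem_integer_of_valuation_eq_one hcinv hcq

end Generic

/-! ## §2 At the CM place: the rescaled uniformiser `ι(c)·τ` and its Eisenstein clauses -/

section Place

variable (L : Type) [Field L] [NumberField L] [IsCMField L] (v : HeightOneSpectrum (𝓞 ↥(maximalRealSubfield L)))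
  (w : PlacesOver L v) (hw : IsCMField.complexConj L • w.1 = w.1) (he : v.asIdeal.ramificationIdx' w.1.asIdeal ≠ 1)

omit [IsCMField L] in
/-- `|ι(c)|_w = 1` for a unit `c` of `L⁺_v` (★ `valued_toPlace`: `|ι y| = |y|^e`). [cite: Serre1979, Ch. II §2] -/
theorem valued_toPlace_eq_one_of_unit {c : v.adicCompletion ↥(maximalRealSubfield L)} (hc : Valued.v c = 1) : Valued.v (toPlace v w c) = 1 := by
  rw [valued_toPlace, hc, one_pow]

omit [IsCMField L] in
/-- `|ι(c)·τ|_w = |τ|_w` for a unit `c`: rescaling by a unit preserves uniformisers. [cite: Serre1979, Ch. I §6 Prop. 18] -/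
theorem valued_toPlace_mul_of_unit {c : v.adicCompletion ↥(maximalRealSubfield L)} (hc : Valued.v c = 1) (τ : w.1.adicCompletion L) :
    Valued.v (toPlace v w c * τ) = Valued.v τ := by
  rw [map_mul, valued_toPlace_eq_one_of_unit L v w hc, one_mul]

omit [IsCMField L] in
/-- The rescaled element `ι(c)·τ` is a uniformiser when `τ` is and `|c| = 1`. [cite: Serre1979, Ch. I §6 Prop. 18] -/
theorem valued_toPlace_mul_eq_exp_neg_one {c : v.adicCompletion ↥(maximalRealSubfield L)} (hc : Valued.v c = 1) {τ : w.1.adicCompletion L}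
    (hτ : Valued.v τ = WithZero.exp (-1 : ℤ)) : Valued.v (toPlace v w c * τ) = WithZero.exp (-1 : ℤ) := by
  rw [valued_toPlace_mul_of_unit L v w hc, hτ]

/-- **TRACE RESCALES LINEARLY**: `τ + στ = ι u` ⇒ `ι(c)τ + σ(ι(c)τ) = ι(c·u)` (`σ` fixes `ι`). [cite: LabesseLanglands1979, §2 p. 7] -/
theorem eisenstein_trace_rescale {τ : w.1.adicCompletion L} {u₀ : v.adicCompletion ↥(maximalRealSubfield L)}
    (htr : τ + galAdicCompletionMap (L := L) (IsCMField.complexConj L) hw τ = toPlace v w u₀) (c : v.adicCompletion ↥(maximalRealSubfield L)) :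
    toPlace v w c * τ + galAdicCompletionMap (L := L) (IsCMField.complexConj L) hw (toPlace v w c * τ) = toPlace v w (c * u₀) := by
  rw [map_mul, galAdicCompletionMap_toPlace (IsCMField.complexConj L) w w hw c, ← mul_add, htr, map_mul]

/-- **NORM RESCALES QUADRATICALLY**: `τ·στ = −ι v` ⇒ `(ι(c)τ)·σ(ι(c)τ) = −ι(c²·v)`. [cite: LabesseLanglands1979, §2 p. 7] -/
theorem eisenstein_norm_rescale {τ : w.1.adicCompletion L} {v₀ : v.adicCompletion ↥(maximalRealSubfield L)}
    (hnm : τ * galAdicCompletionMap (L := L) (IsCMField.complexConj L) hw τ = -toPlace v w v₀) (c : v.adicCompletion ↥(maximalRealSubfield L)) :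
    (toPlace v w c * τ) * galAdicCompletionMap (L := L) (IsCMField.complexConj L) hw (toPlace v w c * τ) = -toPlace v w (c ^ 2 * v₀) := by
  rw [map_mul, galAdicCompletionMap_toPlace (IsCMField.complexConj L) w w hw c, map_mul, map_pow]
  linear_combination (toPlace v w c) ^ 2 * hnm

/-- **THE RESCALED EISENSTEIN EQUATION** `(ι(c)τ)² = ι(c u)·(ι(c)τ) + ι(c² v)` (★ `sq_eq_of_trace_norm`). [cite: Serre1979, Ch. I §6 Prop. 18] -/
theorem eisenstein_sq_rescale {τ : w.1.adicCompletion L} {u₀ v₀ : v.adicCompletion ↥(maximalRealSubfield L)}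
    (htr : τ + galAdicCompletionMap (L := L) (IsCMField.complexConj L) hw τ = toPlace v w u₀)
    (hnm : τ * galAdicCompletionMap (L := L) (IsCMField.complexConj L) hw τ = -toPlace v w v₀) (c : v.adicCompletion ↥(maximalRealSubfield L)) :
    (toPlace v w c * τ) ^ 2 = toPlace v w (c * u₀) * (toPlace v w c * τ) + toPlace v w (c ^ 2 * v₀) :=
  sq_eq_of_trace_norm (eisenstein_trace_rescale L v w hw htr c) (eisenstein_norm_rescale L v w hw hnm c)

/-- `σ(ι(c)τ) = ι(c u) − ι(c)τ` (the conjugate root of the rescaled Eisenstein equation). [cite: Serre1979, Ch. I §6 Prop. 18] -/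
theorem galAdicCompletionMap_toPlace_mul_eq_sub {τ : w.1.adicCompletion L} {u₀ : v.adicCompletion ↥(maximalRealSubfield L)}
    (htr : τ + galAdicCompletionMap (L := L) (IsCMField.complexConj L) hw τ = toPlace v w u₀) (c : v.adicCompletion ↥(maximalRealSubfield L)) :
    galAdicCompletionMap (L := L) (IsCMField.complexConj L) hw (toPlace v w c * τ) = toPlace v w (c * u₀) - toPlace v w c * τ := by
  rw [← eisenstein_trace_rescale L v w hw htr c, add_sub_cancel_left]

omit [IsCMField L] in
/-- `|c·u|_v < 1` for a unit `c` and `|u|_v < 1` (`Valued.v` spelling). [cite: Serre1979, Ch. II §1] -/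
theorem valued_mul_lt_one_of_unit {c u₀ : v.adicCompletion ↥(maximalRealSubfield L)} (hc : Valued.v c = 1) (hu1 : Valued.v u₀ < 1) : Valued.v (c * u₀) < 1 := by
  rw [map_mul, hc, one_mul]; exact hu1

omit [IsCMField L] in
/-- `|c²·v|_v = |v|_v` for a unit `c` (`Valued.v` spelling; with `|v| = exp(−1)` the rescaled `v` is again a uniformiser of `L⁺_v`). [cite: Serre1979, Ch. II §1] -/
theorem valued_sq_mul_of_unit {c v₀ : v.adicCompletion ↥(maximalRealSubfield L)} (hc : Valued.v c = 1) : Valued.v (c ^ 2 * v₀) = Valued.v v₀ := by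
  rw [map_mul, map_pow, hc, one_pow, one_mul]

include he in
/-- **A-p17's binder `hE` FOR THE RESCALED DATUM at the CM place** (★ `quadNormForm_integral_of_ramified` at the uniformiser `ι(c)·τ`). [cite: LabesseLanglands1979, §2 p. 7] -/
theorem quadNormForm_integral_rescale_of_ramified {τ : w.1.adicCompletion L} (hτ : Valued.v τ = WithZero.exp (-1 : ℤ))
    {u₀ v₀ : v.adicCompletion ↥(maximalRealSubfield L)}
    (htr : τ + galAdicCompletionMap (L := L) (IsCMField.complexConj L) hw τ = toPlace v w u₀)
    (hnm : τ * galAdicCompletionMap (L := L) (IsCMField.complexConj L) hw τ = -toPlace v w v₀)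
    {c : v.adicCompletion ↥(maximalRealSubfield L)} (hc : Valued.v c = 1) :
    ∀ p q : v.adicCompletion ↥(maximalRealSubfield L),
      valuation (v.adicCompletion ↥(maximalRealSubfield L)) (p ^ 2 + p * q * (c * u₀) - q ^ 2 * (c ^ 2 * v₀)) ≤ 1 →
        p ∈ 𝒪[v.adicCompletion ↥(maximalRealSubfield L)] ∧ q ∈ 𝒪[v.adicCompletion ↥(maximalRealSubfield L)] :=
  quadNormForm_integral_of_ramified L v w hw he (valued_toPlace_mul_eq_exp_neg_one L v w hc hτ) (eisenstein_trace_rescale L v w hw htr c)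
    (eisenstein_norm_rescale L v w hw hnm c)

include he in
/-- **(R) THE RESCALED EISENSTEIN PACKAGE.**  For a uniformiser `τ` of `L_w` with Eisenstein data `τ + στ = ι u`, `τ·στ = −ι v`, any uniformiser `ϖ_F` of `L⁺_v` with
`|v| = |ϖ_F|` in the road's spelling, and any UNIT `c` of `L⁺_v`, the datum `(τ', u', v') := (ι(c)·τ, c·u, c²·v)` satisfies EVERY clause of ★ `exists_eisensteinBasis_of_ramified`
(B-p17 (g25) (W′1-CM0)): uniformiser, Eisenstein equation, trace, norm, `u' ∈ 𝒪`, `valuation u' < 1`, `valuation v' = valuation ϖ_F`, the basis `L_w = ι L⁺_v ⊕ ι L⁺_v·τ'`,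
the integral basis `ι p + ι q τ' ∈ 𝒪[L_w] ↔ p q ∈ 𝒪`, and A-p17's `hE`. [cite: Serre1979, Ch. I §6 Prop. 18] [cite: LabesseLanglands1979, §2 p. 7] -/
theorem eisensteinBasis_rescale {τ : w.1.adicCompletion L} (hτ : Valued.v τ = WithZero.exp (-1 : ℤ))
    {u₀ v₀ ϖF : v.adicCompletion ↥(maximalRealSubfield L)}
    (htr : τ + galAdicCompletionMap (L := L) (IsCMField.complexConj L) hw τ = toPlace v w u₀)
    (hnm : τ * galAdicCompletionMap (L := L) (IsCMField.complexConj L) hw τ = -toPlace v w v₀)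
    (hu : u₀ ∈ 𝒪[v.adicCompletion ↥(maximalRealSubfield L)])
    (hu1 : valuation (v.adicCompletion ↥(maximalRealSubfield L)) u₀ < 1)
    (hv1 : valuation (v.adicCompletion ↥(maximalRealSubfield L)) v₀ = valuation (v.adicCompletion ↥(maximalRealSubfield L)) ϖF)
    {c : v.adicCompletion ↥(maximalRealSubfield L)} (hc : Valued.v c = 1) :
    Valued.v (toPlace v w c * τ) = WithZero.exp (-1 : ℤ) ∧
    (toPlace v w c * τ) ^ 2 = toPlace v w (c * u₀) * (toPlace v w c * τ) + toPlace v w (c ^ 2 * v₀) ∧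
    toPlace v w c * τ + galAdicCompletionMap (L := L) (IsCMField.complexConj L) hw (toPlace v w c * τ) = toPlace v w (c * u₀) ∧
    (toPlace v w c * τ) * galAdicCompletionMap (L := L) (IsCMField.complexConj L) hw (toPlace v w c * τ) = -toPlace v w (c ^ 2 * v₀) ∧
    c * u₀ ∈ 𝒪[v.adicCompletion ↥(maximalRealSubfield L)] ∧
    valuation (v.adicCompletion ↥(maximalRealSubfield L)) (c * u₀) < 1 ∧
    valuation (v.adicCompletion ↥(maximalRealSubfield L)) (c ^ 2 * v₀) = valuation (v.adicCompletion ↥(maximalRealSubfield L)) ϖF ∧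
    (∀ x : w.1.adicCompletion L, ∃ p q : v.adicCompletion ↥(maximalRealSubfield L), x = toPlace v w p + toPlace v w q * (toPlace v w c * τ)) ∧
    (∀ p q : v.adicCompletion ↥(maximalRealSubfield L),
      toPlace v w p + toPlace v w q * (toPlace v w c * τ) ∈ 𝒪[w.1.adicCompletion L] ↔
        p ∈ 𝒪[v.adicCompletion ↥(maximalRealSubfield L)] ∧ q ∈ 𝒪[v.adicCompletion ↥(maximalRealSubfield L)]) ∧
    (∀ p q : v.adicCompletion ↥(maximalRealSubfield L),
      valuation (v.adicCompletion ↥(maximalRealSubfield L)) (p ^ 2 + p * q * (c * u₀) - q ^ 2 * (c ^ 2 * v₀)) ≤ 1 →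
        p ∈ 𝒪[v.adicCompletion ↥(maximalRealSubfield L)] ∧ q ∈ 𝒪[v.adicCompletion ↥(maximalRealSubfield L)]) := by
  have hc' : valuation (v.adicCompletion ↥(maximalRealSubfield L)) c = 1 := (v_eq_one_iff_valuation_eq_one c).1 hc
  have hτ' := valued_toPlace_mul_eq_exp_neg_one L v w hc hτ
  exact ⟨hτ', eisenstein_sq_rescale L v w hw htr hnm c, eisenstein_trace_rescale L v w hw htr c, eisenstein_norm_rescale L v w hw hnm c,
    mul_mem_integer_of_valuation_eq_one hc' hu, valuation_mul_lt_one_of_valuation_eq_one hc' hu1, valuation_sq_mul_eq_of_valuation_eq_one hc' hv1,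
    exists_eq_toPlace_add_toPlace_mul L v w hw he hτ', toPlace_add_toPlace_mul_mem_integer_iff L v w hw he hτ',
    quadNormForm_integral_rescale_of_ramified L v w hw he hτ htr hnm hc⟩

end Place

/-! ## §3 The companion matrix and the regular representation under `Ad diag(1,c⁻¹)` (over ★ `QuadraticRegularRep.diagonal_inv_mul_regRep_mul_diagonal'`) -/

section Matrices

variable {K : Type*} [Field K]

/-- `det diag(1,c) = c`. [cite: Serre1980Trees, Ch. II §1.3] -/
theorem det_diagonal_one_two (c : K) : (Matrix.diagonal ![(1 : K), c]).det = c := by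
  rw [Matrix.det_diagonal]; simp [Fin.prod_univ_two]

/-- The matrix inverse of `diag(1,c)` is `diag(1,c⁻¹)` (`c ≠ 0`; ★ `QuadraticRegularRep.diagonal_inv_mul_diagonal`) — bridge for consumers who write `(diag(1,c))⁻¹`.
[cite: Serre1980Trees, Ch. II §1.3] -/
theorem diagonal_one_inv_eq (c : K) (hc : c ≠ 0) : (Matrix.diagonal ![(1 : K), c])⁻¹ = Matrix.diagonal ![(1 : K), c⁻¹] :=
  Matrix.inv_eq_left_inv (Literature.NumberTheory.LocalFields.QuadraticRegularRep.diagonal_inv_mul_diagonal hc)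

/-- **THE REGULAR REPRESENTATION RESCALES**: `diag(1,c⁻¹) · !![a, b v; b, a + b u] · diag(1,c) = !![a, b' (c² v); b', a + b' (c u)]` with `b' := b·c⁻¹` — ★ LL (2.1) at
`diag(1,c)` (`QuadraticRegularRep.diagonal_inv_mul_regRep_mul_diagonal'`) re-read in the RESCALED basis `{1, cτ}`: `Ad diag(1,c⁻¹)` maps the torus `L⁺_v[γ_τ]` onto `L⁺_v[γ_{cτ}]`.
[cite: LabesseLanglands1979, §2 (2.1) pp. 7–8] [cite: Serre1980Trees, Ch. II §1.3] -/
theorem regRep_conj_diagonal_eq_regRep_rescale (c u v a b : K) (hc : c ≠ 0) :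
    Matrix.diagonal ![(1 : K), c⁻¹] * !![a, b * v; b, a + b * u] * Matrix.diagonal ![(1 : K), c] =
      !![a, (b * c⁻¹) * (c ^ 2 * v); b * c⁻¹, a + (b * c⁻¹) * (c * u)] := by
  rw [Literature.NumberTheory.LocalFields.QuadraticRegularRep.diagonal_inv_mul_regRep_mul_diagonal' u v c hc a b]
  have h1 : b * v * c = (b * c⁻¹) * (c ^ 2 * v) := by field_simp
  have h2 : a + b * u = a + (b * c⁻¹) * (c * u) := by field_simp
  rw [← h1, ← h2]

/-- The regular-representation SHAPE is preserved by `Ad diag(1,c⁻¹)` (existential form, the shape (P1) exports as `hpos` for the rescaled datum).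
[cite: LabesseLanglands1979, §2 (2.1) pp. 7–8] -/
theorem exists_regRep_conj_diagonal_eq_regRep_rescale (c u v a b : K) (hc : c ≠ 0) :
    ∃ a' b' : K, Matrix.diagonal ![(1 : K), c⁻¹] * !![a, b * v; b, a + b * u] * Matrix.diagonal ![(1 : K), c] = !![a', b' * (c ^ 2 * v); b', a' + b' * (c * u)] :=
  ⟨a, b * c⁻¹, regRep_conj_diagonal_eq_regRep_rescale c u v a b hc⟩

/-- **THE COMPANION MATRIX RESCALES**: `diag(1,c⁻¹) · !![0, v; 1, u] · diag(1,c) = c⁻¹ • !![0, c² v; 1, c u]` — the companion matrix `γ_τ` of `τ` is carried by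
`Ad diag(1,c⁻¹)` to the companion matrix `γ_{cτ}` of `cτ` MODULO THE CENTRE (the scalar `c⁻¹`), so on the tree (where the centre acts trivially) the two tori have the same
vertex action after the conjugation; `det diag(1,c) = c` is the determinant class this costs. [cite: LabesseLanglands1979, §2 (2.1) pp. 7–8] [cite: Serre1980Trees, Ch. II §1.3] -/
theorem companion_conj_diagonal_eq_smul_companion_rescale (c u v : K) (hc : c ≠ 0) :
    Matrix.diagonal ![(1 : K), c⁻¹] * !![(0 : K), v; 1, u] * Matrix.diagonal ![(1 : K), c] = c⁻¹ • !![(0 : K), c ^ 2 * v; 1, c * u] := by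
  have h := regRep_conj_diagonal_eq_regRep_rescale c u v 0 1 hc
  rw [one_mul, zero_add, one_mul] at h
  rw [h]
  ext i j
  fin_cases i <;> fin_cases j <;> simp

end Matrices

end Literature.NumberTheory.Automorphic.UnitaryGroup

end
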